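import Summits.QuantumAdvantage.QuantumAdvantage.Theorems.WalkThreeStepFarReadAlgebra

/-!
# Rung (G♯₂) `ThreeStepFreeRungFive` (item stmt-QuantumAdvantage-23286), architecture (U), the FAR-READ LEMMA 2/6: the PAIR
# IDENTITY of a symmetric position and a far position

Cell qa-qnc0, route OddPrimeWalk, support item stmt-QuantumAdvantage-23286; prover qn-prover-3 g17.

At a register-symmetric position `π` the differential `D_π(x) = reg(x) + reg(σ_π x)` vanishes for every input.  For a second
position `h` (`|π − h| ≥ 2`) put `E(x) := D_π(x) + D_π(σ_h x) = Σ_q fourTerm_q(x)` (§1).  Only the cuts that SEE `π` (sit there or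
read it with non-zero total coefficient) AND SEE `h` survive (`pairSet`, `Esum_eq_sum_pairSet`): the far cut `h` if it reads `π`, the
own cut `π` if it reads `h`, and the DOUBLE READERS of `{π, h}`.  §2 the abstract KILL: in a vanishing sum, a member whose label alone
is rotated by a further involution vanishes (`kill_member`); the transposition at a member's own, unread position is such an involution
(`fourTerm_cornerFlip_of_unread`, `fourTerm_cornerFlip_self`).  §3 closed forms: a double reader contributes `ζ^{label}·(c•1)` with
`c` the four-fold difference of its fire bit (`fourTerm_eq_c4`), the far cut `h` contributes `ζ^{label+1}·(δ•1)` with `δ` the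
`π`-difference of its fire bit (`fourTerm_self`).  §4 ZONE SPLIT of `E` (`fourTerm_sum_split`): a flip of `p` equal bits in a zone
free of member positions and member reads separates the members below the zone from those above.
WHAT THIS IS NOT: no far-read conclusion yet; separation NOT moved.
-/

namespace Summit.QuantumAdvantage.AdviceFreeQNC0.LocalEngine

open Finset Classical

namespace RungU

variable {p n : ℕ}

/-! ### §1 The pair identity -/

/-- the four-input term of cut `q`: its pair terms at `x` and at `σ_h x`. -/
noncomputable def fourTerm (S : ThreeStep p n) (π h : ℕ) (x : Fin n → Bool) (q : Fin (n + 1)) : F4 :=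
  pairTerm S π x q + pairTerm S π (cornerFlip n h x) q

/-- `E(x) = D_π(x) + D_π(σ_h x)`. -/
noncomputable def Esum (S : ThreeStep p n) (π h : ℕ) (x : Fin n → Bool) : F4 := diff S π x + diff S π (cornerFlip n h x)

/-- `D_π = Σ_q pairTerm_q`. -/
theorem diff_eq_sum_pairTerm (S : ThreeStep p n) (k : ℕ) (x : Fin n → Bool) :
    diff S k x = ∑ q : Fin (n + 1), pairTerm S k x q := by
  unfold diff reg pairTerm
  rw [← Finset.sum_add_distrib]

/-- `E = Σ_q fourTerm_q`. -/
theorem Esum_eq_sum (S : ThreeStep p n) (π h : ℕ) (x : Fin n → Bool) :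
    Esum S π h x = ∑ q : Fin (n + 1), fourTerm S π h x q := by
  unfold Esum fourTerm
  rw [diff_eq_sum_pairTerm, diff_eq_sum_pairTerm, ← Finset.sum_add_distrib]

/-- symmetry at `π` makes `E` vanish. -/
theorem Esum_eq_zero_of_sym (S : ThreeStep p n) {π : ℕ} (h : ℕ) (hsym : ∀ y : Fin n → Bool, reg S (cornerFlip n π y) = reg S y)
    (x : Fin n → Bool) : Esum S π h x = 0 := by
  unfold Esum
  rw [diff_eq_zero_of_sym S π x (hsym x), diff_eq_zero_of_sym S π _ (hsym _), add_zero]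

/-- a cut that neither sits at `π` nor reads `π` has vanishing pair term. -/
theorem pairTerm_eq_zero_of_cf (S : ThreeStep p n) (π : ℕ) (x : Fin n → Bool) (q : Fin (n + 1)) (hq : q.val ≠ π)
    (hc : cf S q π = 0) : pairTerm S π x q = 0 := by
  unfold pairTerm
  rw [term_cornerFlip_of_cf S q π hq hc x, F4_add_self]

/-- a cut that neither sits at `h` nor reads `h` has vanishing four-term. -/
theorem fourTerm_eq_zero_of_cf_h (S : ThreeStep p n) {π h : ℕ} (hπh : π + 2 ≤ h ∨ h + 2 ≤ π) (x : Fin n → Bool)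
    (q : Fin (n + 1)) (hq : q.val ≠ h) (hc : cf S q h = 0) : fourTerm S π h x q = 0 := by
  unfold fourTerm pairTerm
  rw [cornerFlip_comm hπh x, term_cornerFlip_of_cf S q h hq hc x, term_cornerFlip_of_cf S q h hq hc (cornerFlip n π x),
    F4_add_self]

/-- the cuts seeing both `π` and `h`. -/
noncomputable def pairSet (S : ThreeStep p n) (π h : ℕ) : Finset (Fin (n + 1)) :=
  univ.filter fun q => (q.val = π ∨ cf S q π ≠ 0) ∧ (q.val = h ∨ cf S q h ≠ 0)

/-- membership in `pairSet`. -/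
theorem mem_pairSet {S : ThreeStep p n} {π h : ℕ} {q : Fin (n + 1)} :
    q ∈ pairSet S π h ↔ (q.val = π ∨ cf S q π ≠ 0) ∧ (q.val = h ∨ cf S q h ≠ 0) := by
  unfold pairSet
  rw [Finset.mem_filter]
  simp

/-- non-members contribute nothing to `E`. -/
theorem fourTerm_eq_zero_of_not_mem (S : ThreeStep p n) {π h : ℕ} (hπh : π + 2 ≤ h ∨ h + 2 ≤ π) (x : Fin n → Bool)
    (q : Fin (n + 1)) (hq : q ∉ pairSet S π h) : fourTerm S π h x q = 0 := by
  rw [mem_pairSet, not_and_or] at hq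
  rcases hq with hq | hq
  · push Not at hq
    unfold fourTerm
    rw [pairTerm_eq_zero_of_cf S π x q hq.1 hq.2, pairTerm_eq_zero_of_cf S π _ q hq.1 hq.2, add_zero]
  · push Not at hq
    exact fourTerm_eq_zero_of_cf_h S hπh x q hq.1 hq.2

/-- **`E = Σ_{pairSet} fourTerm`**. -/
theorem Esum_eq_sum_pairSet (S : ThreeStep p n) {π h : ℕ} (hπh : π + 2 ≤ h ∨ h + 2 ≤ π) (x : Fin n → Bool) :
    Esum S π h x = ∑ q ∈ pairSet S π h, fourTerm S π h x q := by
  rw [Esum_eq_sum]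
  symm
  exact Finset.sum_subset (Finset.subset_univ _) fun q _ hq => fourTerm_eq_zero_of_not_mem S hπh x q hq

/-- the sum over any superset of `pairSet` vanishes under symmetry at `π`. -/
theorem sum_fourTerm_eq_zero (S : ThreeStep p n) {π h : ℕ} (hπh : π + 2 ≤ h ∨ h + 2 ≤ π)
    (hsym : ∀ y : Fin n → Bool, reg S (cornerFlip n π y) = reg S y) {T : Finset (Fin (n + 1))} (hT : pairSet S π h ⊆ T)
    (x : Fin n → Bool) : ∑ q ∈ T, fourTerm S π h x q = 0 := by
  rw [← Finset.sum_subset hT fun q _ hq => fourTerm_eq_zero_of_not_mem S hπh x q hq, ← Esum_eq_sum_pairSet S hπh x]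
  exact Esum_eq_zero_of_sym S h hsym x

/-! ### §2 The kill -/

/-- **abstract kill**: two vanishing sums over the same index set whose terms agree except at `q₀`, where the second is the first
rotated by `ζ^s`, `s ≠ 0`: the `q₀`-term vanishes. -/
theorem kill_member {ι : Type*} (T : Finset ι) (F G : ι → F4) (q₀ : ι) (hq₀ : q₀ ∈ T) (s : ZMod 3) (hs : s ≠ 0)
    (hF : ∑ q ∈ T, F q = 0) (hG : ∑ q ∈ T, G q = 0) (hsame : ∀ q ∈ T, q ≠ q₀ → G q = F q)
    (hrot : G q₀ = rotZ s (F q₀)) : F q₀ = 0 := by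
  have h1 : ∑ q ∈ T, (F q + G q) = F q₀ + rotZ s (F q₀) := by
    rw [← Finset.add_sum_erase T _ hq₀, hrot]
    have : ∑ q ∈ T.erase q₀, (F q + G q) = 0 :=
      Finset.sum_eq_zero fun q hq => by
        rw [hsame q (Finset.mem_of_mem_erase hq) (Finset.ne_of_mem_erase hq), F4_add_self]
    rw [this, add_zero]
  rw [Finset.sum_add_distrib, hF, hG, add_zero] at h1
  exact eq_zero_of_add_rotZ s hs _ h1.symm

/-- a transposition at a position `k` that cut `q` neither sits at nor reads (and away from `π`, `h`) leaves its four-term unchanged. -/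
theorem fourTerm_cornerFlip_of_unread (S : ThreeStep p n) {π h k : ℕ} (hkπ : π + 2 ≤ k ∨ k + 2 ≤ π) (hkh : h + 2 ≤ k ∨ k + 2 ≤ h)
    (x : Fin n → Bool) (q : Fin (n + 1)) (hq : q.val ≠ k) (hc : cf S q k = 0) :
    fourTerm S π h (cornerFlip n k x) q = fourTerm S π h x q := by
  unfold fourTerm pairTerm
  have hπk : cornerFlip n π (cornerFlip n k x) = cornerFlip n k (cornerFlip n π x) :=
    cornerFlip_comm (by omega) x
  have hhk : cornerFlip n h (cornerFlip n k x) = cornerFlip n k (cornerFlip n h x) :=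
    cornerFlip_comm (by omega) x
  have hπhk : cornerFlip n π (cornerFlip n k (cornerFlip n h x)) = cornerFlip n k (cornerFlip n π (cornerFlip n h x)) :=
    cornerFlip_comm (by omega) _
  rw [hπk, hhk, hπhk, term_cornerFlip_of_cf S q k hq hc, term_cornerFlip_of_cf S q k hq hc,
    term_cornerFlip_of_cf S q k hq hc, term_cornerFlip_of_cf S q k hq hc]

/-- `Ten` direction: the transposed input has label one less at the transposed position, at each of the four inputs. -/
theorem term_cornerFlip_self_ten (S : ThreeStep p n) {k : ℕ} (hk1 : 1 ≤ k) (hkn : k < n) {x : Fin n → Bool} (hx : Ten x k)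
    (q : Fin (n + 1)) (hq : q.val = k) (hc : cf S q k = 0) :
    term S (cornerFlip n k x) q = rotZ 2 (term S x q) := by
  rw [term_eq_rotZ_bt, term_eq_rotZ_bt, y_cornerFlip_of_cf S q k hc x, rotZ_rotZ]
  congr 1
  have e := lab_cornerFlip_self hx hk1 q hq hkn
  have : lab (cornerFlip n k x) q = lab x q - 1 := by rw [← e]; ring
  rw [this]
  have : ∀ a : ZMod 3, a - 1 = 2 + a := by decide
  exact this _

/-- **the transposition at a member's own unread position rotates its four-term by `ζ²`** (`Ten` direction; `|k−π|, |k−h| ≥ 2`). -/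
theorem fourTerm_cornerFlip_self (S : ThreeStep p n) {π h k : ℕ} (hkπ : π + 2 ≤ k ∨ k + 2 ≤ π) (hkh : h + 2 ≤ k ∨ k + 2 ≤ h)
    (hk1 : 1 ≤ k) (hkn : k < n) {x : Fin n → Bool} (hx : Ten x k) (q : Fin (n + 1)) (hq : q.val = k) (hc : cf S q k = 0) :
    fourTerm S π h (cornerFlip n k x) q = rotZ 2 (fourTerm S π h x q) := by
  unfold fourTerm pairTerm
  have hπk : cornerFlip n π (cornerFlip n k x) = cornerFlip n k (cornerFlip n π x) :=
    cornerFlip_comm (by omega) x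
  have hhk : cornerFlip n h (cornerFlip n k x) = cornerFlip n k (cornerFlip n h x) :=
    cornerFlip_comm (by omega) x
  have hπhk : cornerFlip n π (cornerFlip n k (cornerFlip n h x)) = cornerFlip n k (cornerFlip n π (cornerFlip n h x)) :=
    cornerFlip_comm (by omega) _
  rw [hπk, hhk, hπhk]
  have t1 := term_cornerFlip_self_ten S hk1 hkn hx q hq hc
  have t2 := term_cornerFlip_self_ten S hk1 hkn (hx.cornerFlip_far π (by omega)) q hq hc
  have t3 := term_cornerFlip_self_ten S hk1 hkn (hx.cornerFlip_far h (by omega)) q hq hc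
  have t4 := term_cornerFlip_self_ten S hk1 hkn ((hx.cornerFlip_far h (by omega)).cornerFlip_far π (by omega)) q hq hc
  rw [t1, t2, t3, t4, rotZ_map_add, rotZ_map_add, rotZ_map_add]

/-- **KILL OF AN UNREAD MEMBER**: if the four-term sum over `T ⊇ pairSet` vanishes at `x` and at `σ_k x` (symmetry at `π`), the
member positioned at `k` is read by no member of `T`, does not read itself, and `x` has `10` at `k`, then its four-term vanishes. -/
theorem fourTerm_eq_zero_of_unread (S : ThreeStep p n) {π h k : ℕ} (hπh : π + 2 ≤ h ∨ h + 2 ≤ π)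
    (hkπ : π + 2 ≤ k ∨ k + 2 ≤ π) (hkh : h + 2 ≤ k ∨ k + 2 ≤ h) (hk1 : 1 ≤ k) (hkn : k < n)
    (hsym : ∀ y : Fin n → Bool, reg S (cornerFlip n π y) = reg S y) {T : Finset (Fin (n + 1))} (hT : pairSet S π h ⊆ T)
    (q₀ : Fin (n + 1)) (hq₀T : q₀ ∈ T) (hq₀ : q₀.val = k) (hunread : ∀ q ∈ T, cf S q k = 0)
    {x : Fin n → Bool} (hx : Ten x k) : fourTerm S π h x q₀ = 0 := by
  apply kill_member T (fourTerm S π h x) (fourTerm S π h (cornerFlip n k x)) q₀ hq₀T 2 (by decide)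
    (sum_fourTerm_eq_zero S hπh hsym hT x) (sum_fourTerm_eq_zero S hπh hsym hT _)
  · intro q hq hne
    have hqk : q.val ≠ k := fun e => hne (Fin.ext (e.trans hq₀.symm))
    exact fourTerm_cornerFlip_of_unread S hkπ hkh x q hqk (hunread q hq)
  · exact fourTerm_cornerFlip_self S hkπ hkh hk1 hkn hx q₀ hq₀ (hunread q₀ hq₀T)

/-! ### §3 Closed forms -/

/-- the `π`-difference of the fire bit of `q`. -/
def dlt (S : ThreeStep p n) (π : ℕ) (x : Fin n → Bool) (q : Fin (n + 1)) : Bool := xor (S.y q x) (S.y q (cornerFlip n π x))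

/-- the four-fold difference of the fire bit of `q`. -/
def c4 (S : ThreeStep p n) (π h : ℕ) (x : Fin n → Bool) (q : Fin (n + 1)) : Bool :=
  xor (dlt S π x q) (dlt S π (cornerFlip n h x) q)

/-- the pair term of a cut not positioned at `π`: `ζ^{label} · (δ • 1)`. -/
theorem pairTerm_eq_dlt (S : ThreeStep p n) (π : ℕ) (x : Fin n → Bool) (q : Fin (n + 1)) (hq : q.val ≠ π) :
    pairTerm S π x q = rotZ (lab x q) (bt (dlt S π x q)) := by
  unfold pairTerm dlt
  rw [term_eq_rotZ_bt, term_eq_rotZ_bt, lab_cornerFlip_of_ne x π q hq, bt_xor, rotZ_map_add]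

/-- **double readers**: the four-term of a cut positioned neither at `π` nor at `h` is `ζ^{label} · (c • 1)`. -/
theorem fourTerm_eq_c4 (S : ThreeStep p n) (π h : ℕ) (x : Fin n → Bool) (q : Fin (n + 1)) (hqπ : q.val ≠ π) (hqh : q.val ≠ h) :
    fourTerm S π h x q = rotZ (lab x q) (bt (c4 S π h x q)) := by
  unfold fourTerm c4
  rw [pairTerm_eq_dlt S π x q hqπ, pairTerm_eq_dlt S π _ q hqπ, lab_cornerFlip_of_ne x h q hqh, bt_xor, rotZ_map_add]

/-- auxiliary: `ζ^e y + ζ^{e-1} y = ζ^{e+1} y`. -/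
theorem rotZ_add_rotZ_pred (e : ZMod 3) (y : F4) : rotZ e y + rotZ (e - 1) y = rotZ (e + 1) y := by
  revert e y; decide

/-- **the far cut itself** (not reading its own position, `10` at `h`): `fourTerm_h = ζ^{label+1} · (δ • 1)`. -/
theorem fourTerm_self (S : ThreeStep p n) {π h : ℕ} (hπh : π + 2 ≤ h ∨ h + 2 ≤ π) (hh1 : 1 ≤ h) (hhn : h < n)
    {x : Fin n → Bool} (hx : Ten x h) (q : Fin (n + 1)) (hq : q.val = h) (hself : cf S q h = 0) :
    fourTerm S π h x q = rotZ (lab x q + 1) (bt (dlt S π x q)) := by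
  have hqπ : q.val ≠ π := by omega
  unfold fourTerm
  rw [pairTerm_eq_dlt S π x q hqπ, pairTerm_eq_dlt S π _ q hqπ]
  have hd : dlt S π (cornerFlip n h x) q = dlt S π x q := by
    unfold dlt
    rw [cornerFlip_comm hπh x, y_cornerFlip_of_cf S q h hself x, y_cornerFlip_of_cf S q h hself _]
  have hl : lab (cornerFlip n h x) q = lab x q - 1 := by
    have e := lab_cornerFlip_self hx hh1 q hq hhn
    rw [← e]; ring
  rw [hd, hl, rotZ_add_rotZ_pred]

/-- the self-reading variant: `fourTerm_h = ζ^{label}·(δ(x)•1) + ζ^{label−1}·(δ(σ_h x)•1)`. -/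
theorem fourTerm_self_read (S : ThreeStep p n) {π h : ℕ} (hh1 : 1 ≤ h) (hhn : h < n)
    {x : Fin n → Bool} (hx : Ten x h) (q : Fin (n + 1)) (hq : q.val = h) (hqπ : q.val ≠ π) :
    fourTerm S π h x q = rotZ (lab x q) (bt (dlt S π x q) + rotZ 2 (bt (dlt S π (cornerFlip n h x) q))) := by
  unfold fourTerm
  rw [pairTerm_eq_dlt S π x q hqπ, pairTerm_eq_dlt S π _ q hqπ]
  have hl : lab (cornerFlip n h x) q = lab x q + 2 := by
    have e := lab_cornerFlip_self hx hh1 q hq hhn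
    rw [← e]
    have : ∀ a : ZMod 3, a = a + 1 + 2 := by decide
    exact this _
  rw [hl, rotZ_map_add, ← rotZ_rotZ]

/-! ### §4 Zone split of a four-term sum -/

/-- flipping coordinates away from `k − 1, k` commutes with the transposition at `k`. -/
theorem flipOn_cornerFlip_comm (F : Finset (Fin n)) (k : ℕ) (hF : ∀ i ∈ F, i.val + 1 ≠ k ∧ i.val ≠ k) (x : Fin n → Bool) :
    flipOn F (cornerFlip n k x) = cornerFlip n k (flipOn F x) := by
  funext i
  by_cases hk : 1 ≤ k ∧ k < n
  · by_cases h1 : i.val + 1 = k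
    · have hi : i = ⟨k - 1, by omega⟩ := Fin.ext (by simp; omega)
      have hni : i ∉ F := fun hm => (hF i hm).1 h1
      have hnk : (⟨k, hk.2⟩ : Fin n) ∉ F := fun hm => (hF _ hm).2 rfl
      rw [flipOn_of_not_mem hni, hi, cornerFlip_apply_left k x hk.1 hk.2, cornerFlip_apply_left k _ hk.1 hk.2,
        flipOn_of_not_mem hnk]
    · by_cases h2 : i.val = k
      · have hi : i = ⟨k, hk.2⟩ := Fin.ext (by simpa using h2)
        have hni : i ∉ F := fun hm => (hF i hm).2 h2
        have hnk : (⟨k - 1, by omega⟩ : Fin n) ∉ F := fun hm => (hF _ hm).1 (by simp; omega)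
        rw [flipOn_of_not_mem hni, hi, cornerFlip_apply_right k x hk.1 hk.2, cornerFlip_apply_right k _ hk.1 hk.2,
          flipOn_of_not_mem hnk]
      · rw [DensePeel.cornerFlip_apply_of_ne k _ i h1 h2]
        unfold flipOn
        by_cases hm : i ∈ F
        · rw [if_pos hm, if_pos hm, DensePeel.cornerFlip_apply_of_ne k x i h1 h2]
        · rw [if_neg hm, if_neg hm, DensePeel.cornerFlip_apply_of_ne k x i h1 h2]
  · unfold cornerFlip
    rw [dif_neg hk, dif_neg hk]

/-- a zone flip of `x` is a zone flip of any input agreeing with `x` on the flipped set. -/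
theorem ZoneFlip.of_agree {x x' : Fin n → Bool} {F : Finset (Fin n)} {z m : ℕ} (hF : ZoneFlip p x F z m)
    (hag : ∀ i ∈ F, x' i = x i) : ZoneFlip p x' F z m := by
  refine ⟨hF.card_eq, hF.inside, ?_⟩
  rcases hF.const with hc | hc
  · left; intro i hi; rw [hag i hi]; exact hc i hi
  · right; intro i hi; rw [hag i hi]; exact hc i hi

/-- a transposition away from the zone does not touch the zone bits. -/
theorem cornerFlip_agree_zone {F : Finset (Fin n)} (k : ℕ) (hF : ∀ i ∈ F, i.val + 1 ≠ k ∧ i.val ≠ k) (x : Fin n → Bool) :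
    ∀ i ∈ F, cornerFlip n k x i = x i := fun i hi =>
  DensePeel.cornerFlip_apply_of_ne k x i (hF i hi).1 (hF i hi).2

/-- one term under a zone flip: unchanged below the zone, rotated by `ζ^s` above it (`s = ±p`, the sign of the flip). -/
theorem term_flipOn_zone (hp : 1 ≤ p) (S : ThreeStep p n) {x : Fin n → Bool} {F : Finset (Fin n)} {z m : ℕ} (hF : ZoneFlip p x F z m)
    (hzn : z + m ≤ n) (q : Fin (n + 1)) (hreads : ∀ r, cf S q r ≠ 0 → ¬ (z < r ∧ r < z + m)) :
    (q.val ≤ z → term S (flipOn F x) q = term S x q) ∧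
    (z + m ≤ q.val → term S (flipOn F x) q =
      rotZ (if (∀ i ∈ F, x i = false) then ((p : ℕ) : ZMod 3) else -((p : ℕ) : ZMod 3)) (term S x q)) := by
  have hJ : S.y q (flipOn F x) = S.y q x :=
    y_congr_cf S q (fun r hr => hF.wtPrefix_mod_eq (hreads r hr)) (hF.wt_mod_eq hzn)
  constructor
  · intro hq
    exact term_congr S q hJ (hF.wtPrefix_of_le hq)
  · intro hq
    have eF : (F.filter fun i => i.val < q.val) = F :=
      Finset.filter_true_of_mem fun i hi => by have := (hF.inside i hi).2; omega
    rcases hF.const with hc | hc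
    · rw [if_pos hc]
      apply term_shift S q p hJ
      rw [wtPrefix_flipOn_false F x hc q.val, eF, hF.card_eq]
    · have hnc : ¬ (∀ i ∈ F, x i = false) := by
        intro h'
        have hne : F.Nonempty := by rw [← Finset.card_pos, hF.card_eq]; exact hp
        obtain ⟨i, hi⟩ := hne
        have := h' i hi
        rw [hc i hi] at this
        exact absurd this (by decide)
      rw [if_neg hnc]
      apply term_shift_rev S q p hJ
      have h := wtPrefix_flipOn_true F x hc q.val
      rw [eF, hF.card_eq] at h
      exact h

/-- the sign of a zone flip. -/
noncomputable def zsign (p : ℕ) (x : Fin n → Bool) (F : Finset (Fin n)) : ZMod 3 :=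
  if (∀ i ∈ F, x i = false) then ((p : ℕ) : ZMod 3) else -((p : ℕ) : ZMod 3)

/-- the sign is non-zero when `3 ∤ p`. -/
theorem zsign_ne_zero (hp3 : p % 3 ≠ 0) (x : Fin n → Bool) (F : Finset (Fin n)) : zsign p x F ≠ 0 := by
  unfold zsign
  split_ifs
  · exact cast_p_ne_zero hp3
  · exact neg_ne_zero.mpr (cast_p_ne_zero hp3)

/-- the sign only depends on the zone bits. -/
theorem zsign_congr {x x' : Fin n → Bool} (F : Finset (Fin n)) (hag : ∀ i ∈ F, x' i = x i) : zsign p x' F = zsign p x F := by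
  unfold zsign
  have : (∀ i ∈ F, x' i = false) ↔ (∀ i ∈ F, x i = false) := by
    constructor
    · intro h i hi; rw [← hag i hi]; exact h i hi
    · intro h i hi; rw [hag i hi]; exact h i hi
  simp only [this]

/-- **one four-term under a zone flip**: unchanged if the cut sits below the zone, rotated by the sign if above, provided the zone
avoids the bits `π−1, π, h−1, h` and the cut's effective reads are not strictly inside the zone. -/
theorem fourTerm_flipOn_zone (hp : 1 ≤ p) (S : ThreeStep p n) {π h : ℕ} {x : Fin n → Bool} {F : Finset (Fin n)} {z m : ℕ}
    (hF : ZoneFlip p x F z m) (hzn : z + m ≤ n)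
    (hFπ : ∀ i ∈ F, i.val + 1 ≠ π ∧ i.val ≠ π) (hFh : ∀ i ∈ F, i.val + 1 ≠ h ∧ i.val ≠ h)
    (q : Fin (n + 1)) (hreads : ∀ r, cf S q r ≠ 0 → ¬ (z < r ∧ r < z + m)) :
    (q.val ≤ z → fourTerm S π h (flipOn F x) q = fourTerm S π h x q) ∧
    (z + m ≤ q.val → fourTerm S π h (flipOn F x) q = rotZ (zsign p x F) (fourTerm S π h x q)) := by
  -- the four inputs and their zone flips
  have cπ : flipOn F (cornerFlip n π x) = cornerFlip n π (flipOn F x) := flipOn_cornerFlip_comm F π hFπ x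
  have ch : flipOn F (cornerFlip n h x) = cornerFlip n h (flipOn F x) := flipOn_cornerFlip_comm F h hFh x
  have cπh : flipOn F (cornerFlip n π (cornerFlip n h x)) = cornerFlip n π (cornerFlip n h (flipOn F x)) := by
    rw [flipOn_cornerFlip_comm F π hFπ, ch]
  have aπ := cornerFlip_agree_zone π hFπ x
  have ah := cornerFlip_agree_zone h hFh x
  have aπh : ∀ i ∈ F, cornerFlip n π (cornerFlip n h x) i = x i := fun i hi => by
    rw [cornerFlip_agree_zone π hFπ _ i hi, ah i hi]
  have hF1 := hF.of_agree aπ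
  have hF2 := hF.of_agree ah
  have hF3 := hF.of_agree aπh
  have t0 := term_flipOn_zone hp S hF hzn q hreads
  have t1 := term_flipOn_zone hp S hF1 hzn q hreads
  have t2 := term_flipOn_zone hp S hF2 hzn q hreads
  have t3 := term_flipOn_zone hp S hF3 hzn q hreads
  have s1 : zsign p (cornerFlip n π x) F = zsign p x F := zsign_congr F aπ
  have s2 : zsign p (cornerFlip n h x) F = zsign p x F := zsign_congr F ah
  have s3 : zsign p (cornerFlip n π (cornerFlip n h x)) F = zsign p x F := zsign_congr F aπh
  unfold zsign at s1 s2 s3 t0 t1 t2 t3 ⊢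
  unfold fourTerm pairTerm
  rw [← cπh, ← cπ, ← ch]
  constructor
  · intro hq
    rw [t0.1 hq, t1.1 hq, t2.1 hq, t3.1 hq]
  · intro hq
    rw [t0.2 hq, t1.2 hq, t2.2 hq, t3.2 hq, s1, s2, s3, rotZ_map_add, rotZ_map_add, rotZ_map_add]

/-- **ZONE SPLIT**: if the four-term sum over `T` vanishes at `x` and at a zone flip of `x`, every member of `T` sits below the zone
or above it, and no member read is strictly inside, then the members below and the members above cancel separately (`3 ∤ p`). -/
theorem fourTerm_sum_split (hp : 1 ≤ p) (hp3 : p % 3 ≠ 0) (S : ThreeStep p n) {π h : ℕ} {x : Fin n → Bool} {F : Finset (Fin n)} {z m : ℕ}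
    (hF : ZoneFlip p x F z m) (hzn : z + m ≤ n)
    (hFπ : ∀ i ∈ F, i.val + 1 ≠ π ∧ i.val ≠ π) (hFh : ∀ i ∈ F, i.val + 1 ≠ h ∧ i.val ≠ h)
    {T : Finset (Fin (n + 1))} (hpos : ∀ q ∈ T, q.val ≤ z ∨ z + m ≤ q.val)
    (hreads : ∀ q ∈ T, ∀ r, cf S q r ≠ 0 → ¬ (z < r ∧ r < z + m))
    (h0 : ∑ q ∈ T, fourTerm S π h x q = 0) (h1 : ∑ q ∈ T, fourTerm S π h (flipOn F x) q = 0) :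
    ∑ q ∈ T.filter (fun q => q.val ≤ z), fourTerm S π h x q = 0 ∧
    ∑ q ∈ T.filter (fun q => ¬ q.val ≤ z), fourTerm S π h x q = 0 := by
  set A := ∑ q ∈ T.filter (fun q => q.val ≤ z), fourTerm S π h x q with hA
  set B := ∑ q ∈ T.filter (fun q => ¬ q.val ≤ z), fourTerm S π h x q with hB
  have e0 : A + B = 0 := by rw [hA, hB, Finset.sum_filter_add_sum_filter_not]; exact h0
  have e1 : A + rotZ (zsign p x F) B = 0 := by
    rw [← h1, ← Finset.sum_filter_add_sum_filter_not T (fun q => q.val ≤ z), hA, hB, rotZ_sum]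
    congr 1
    · apply Finset.sum_congr rfl
      intro q hq
      rw [Finset.mem_filter] at hq
      exact ((fourTerm_flipOn_zone hp S hF hzn hFπ hFh q (hreads q hq.1)).1 hq.2).symm
    · apply Finset.sum_congr rfl
      intro q hq
      rw [Finset.mem_filter] at hq
      have hq' : z + m ≤ q.val := by rcases hpos q hq.1 with h' | h' <;> omega
      exact ((fourTerm_flipOn_zone hp S hF hzn hFπ hFh q (hreads q hq.1)).2 hq').symm
  have key : ∀ (a b c : F4), a + b = 0 → a + c = 0 → b + c = 0 := by decide
  have hB0 := eq_zero_of_add_rotZ (zsign p x F) (zsign_ne_zero hp3 x F) B (key _ _ _ e0 e1)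
  refine ⟨?_, hB0⟩
  rw [hB0, add_zero] at e0
  exact e0

end RungU

end Summit.QuantumAdvantage.AdviceFreeQNC0.LocalEngine
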